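import Mathlib
import HarnessLib
import Summits.Ventures.LatticeQCDFlow.Exactness.SU2MomentumLawMoments

/-!
# The `SU(2)` momentum heat-bath checks, exactly: `E T_κ = 3|ι|/2`, the links are independent, `Var T_κ = 3|ι|/2`

HONEST FRAMING: exact (Metropolis-corrected) sampling algorithms for lattice gauge theory;
figures of merit are autocorrelation/cost numbers at stated couplings and volumes; no
continuum-physics claim.

Venture `LatticeQCDFlow` (cell pub-lqcd), topic `Exactness`, FANOUT row 14 (eng-flowhmc; the `SU(2)`
rung of the engine — the row's 4⁴ acceptance run: momenta `p_l ∈ ℝ³` in Pauli coordinates, refresh law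
`su2MomentumLaw κ = Z⁻¹e^{−T_κ}dp`, `T_κ(p) = κΣ_l‖p_l‖²`).  NEW WORK of the cell over
`SU2MomentumLawMoments` (radial Gaussian moments on `ℝ³`, one-link Tonelli, `E‖p_l‖² = 3/(2κ)`) and
`SU2LeapfrogHMC` (`Z = ((π/κ)^{3/2})^{|ι|}`); nothing here is cited as a fact.

* §1 **the fourth radial moment** `∫‖v‖⁴e^{−κ‖v‖²} = (15/(4κ²))∫e^{−κ‖v‖²}` (`Γ(7/2) = (5/2)(3/2)Γ(3/2)`),
  hence **`E‖p_l‖⁴ = 15/(4κ²)`** and **`Var(κ‖p_l‖²) = E(κ‖p_l‖² − 3/2)² = 3/2`** per link;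
* §2 **the links are independent under the heat-bath**: Tonelli for a product of one-link observables
  against `e^{−T_κ}` and **`E ∏_m φ_m(p_m) = ∏_m (∫φ_m e^{−κ‖v‖²})/(∫e^{−κ‖v‖²})`**;
* §3 **`E ‖p_l‖²‖p_{l'}‖² = (3/(2κ))²` for `l ≠ l'`**, **`E T_κ = 3|ι|/2`**, **`E T_κ² = 3|ι|/2 + (3|ι|/2)²`**
  and **`Var T_κ = E(T_κ − 3|ι|/2)² = 3|ι|/2`** — `κ`-free: the `⟨K⟩ = #dof/2 ± √(#dof/2)` check of the
  heat-bath with `#dof = 3|ι|` (on the row's `4⁴` torus, `|ι| = 4·4⁴`).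

NOT CLAIMED: the full (`½χ²_{3|ι|}`) law of `T_κ`; anything numerical; floating point.
-/

noncomputable section
namespace Summit.Ventures.LatticeQCDFlow.Exactness

open Set MeasureTheory Metric Filter
open scoped ENNReal

/-! ## §1 The fourth radial moment and the one-link variance -/

section OneLink

/-- **`∫_{ℝ³} ‖v‖⁴ e^{−κ‖v‖²} = (15/(4κ²)) ∫_{ℝ³} e^{−κ‖v‖²}`** (`Γ(7/2) = (5/2)(3/2)Γ(3/2)`). -/
theorem integral_norm_pow_four_mul_exp_neg_mul_sq_norm_three {κ : ℝ} (hκ : 0 < κ) :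
    ∫ v : EuclideanSpace ℝ (Fin 3), ‖v‖ ^ 4 * Real.exp (-κ * ‖v‖ ^ 2) =
      15 / (4 * κ ^ 2) * ∫ v : EuclideanSpace ℝ (Fin 3), Real.exp (-κ * ‖v‖ ^ 2) := by
  rw [integral_norm_pow_mul_exp_neg_mul_sq_norm_three hκ 4, integral_exp_neg_mul_sq_norm_three_radial hκ]
  have h7 : Real.Gamma ((((4 : ℕ) : ℝ) + 3) / 2) = 15 / 4 * Real.Gamma ((3 : ℝ) / 2) := by
    rw [show (((4 : ℕ) : ℝ) + 3) / 2 = (3 : ℝ) / 2 + 1 + 1 by norm_num, Real.Gamma_add_one (by norm_num),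
      Real.Gamma_add_one (by norm_num)]
    ring
  have hk : κ ^ (-(((4 : ℕ) : ℝ) + 3) / 2) = κ ^ (-(3 : ℝ) / 2) * (κ ^ 2)⁻¹ := by
    rw [show (-(((4 : ℕ) : ℝ) + 3) / 2) = (-(3 : ℝ) / 2) + (-2) by norm_num, Real.rpow_add hκ,
      show (-2 : ℝ) = -((2 : ℕ) : ℝ) by norm_num, Real.rpow_neg hκ.le, Real.rpow_natCast]
  rw [h7, hk]
  field_simp

variable {ι : Type*} [Fintype ι] [DecidableEq ι]

/-- **`E‖p_l‖⁴ = 15/(4κ²)`** under `su2MomentumLaw κ`. -/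
theorem integral_norm_apply_pow_four_su2MomentumLaw {κ : ℝ} (hκ : 0 < κ) (l : ι) :
    ∫ p, ‖p l‖ ^ 4 ∂(su2MomentumLaw (ι := ι) κ) = 15 / (4 * κ ^ 2) := by
  rw [integral_norm_apply_pow_su2MomentumLaw hκ 4 l, integral_norm_pow_four_mul_exp_neg_mul_sq_norm_three hκ,
    mul_div_assoc, div_self (integral_exp_neg_mul_sq_norm_three_pos hκ).ne', mul_one]

/-- **`Var(κ‖p_l‖²) = E(κ‖p_l‖² − 3/2)² = 3/2`** per link (`E‖p_l‖² = 3/(2κ)`, `E‖p_l‖⁴ = 15/(4κ²)`). -/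
theorem variance_kinetic_apply_su2MomentumLaw {κ : ℝ} (hκ : 0 < κ) (l : ι) :
    ∫ p, (κ * ‖p l‖ ^ 2 - 3 / 2) ^ 2 ∂(su2MomentumLaw (ι := ι) κ) = 3 / 2 := by
  haveI : Fact (0 < κ) := ⟨hκ⟩
  have hi4 := integrable_norm_apply_pow_su2MomentumLaw (ι := ι) hκ 4 l
  have hi2 := integrable_norm_apply_pow_su2MomentumLaw (ι := ι) hκ 2 l
  have h4 := integral_norm_apply_pow_four_su2MomentumLaw (ι := ι) hκ l
  have h2 := integral_norm_apply_sq_su2MomentumLaw (ι := ι) hκ l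
  have hexp : ∀ p : ι → EuclideanSpace ℝ (Fin 3), (κ * ‖p l‖ ^ 2 - 3 / 2) ^ 2 =
      κ ^ 2 * ‖p l‖ ^ 4 - 3 * κ * ‖p l‖ ^ 2 + 9 / 4 := fun p => by ring
  simp_rw [hexp]
  have hA : Integrable (fun p : ι → EuclideanSpace ℝ (Fin 3) => κ ^ 2 * ‖p l‖ ^ 4) (su2MomentumLaw (ι := ι) κ) := hi4.const_mul _
  have hB : Integrable (fun p : ι → EuclideanSpace ℝ (Fin 3) => 3 * κ * ‖p l‖ ^ 2) (su2MomentumLaw (ι := ι) κ) := hi2.const_mul _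
  have hsub : Integrable (fun p : ι → EuclideanSpace ℝ (Fin 3) => κ ^ 2 * ‖p l‖ ^ 4 - 3 * κ * ‖p l‖ ^ 2) (su2MomentumLaw (ι := ι) κ) :=
    hA.sub hB
  rw [integral_add hsub (integrable_const _), integral_sub hA hB, integral_const_mul, integral_const_mul, integral_const,
    smul_eq_mul, probReal_univ, one_mul, h4, h2]
  field_simp
  ring

end OneLink

/-! ## §2 The links are independent under the heat-bath -/

section Product

variable {ι : Type*} [Fintype ι] [DecidableEq ι]

omit [DecidableEq ι] in
/-- **Tonelli for a product of one-link observables against `e^{−T_κ}`**: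
`∫⁻ ∏_m φ_m(p_m) e^{−T_κ(p)} dp = ∏_m ∫ φ_m e^{−κ‖v‖²} dv` (`φ_m ≥ 0` measurable, `φ_m e^{−κ‖v‖²}` integrable). -/
theorem lintegral_prod_apply_su2MomentumWeight {κ : ℝ} {φ : ι → EuclideanSpace ℝ (Fin 3) → ℝ}
    (hφ0 : ∀ m v, 0 ≤ φ m v) (hφm : ∀ m, Measurable (φ m))
    (hφi : ∀ m, Integrable (fun v => φ m v * Real.exp (-κ * ‖v‖ ^ 2))) :
    ∫⁻ p, ENNReal.ofReal (∏ m, φ m (p m)) ∂(su2MomentumWeight (ι := ι) κ) =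
      ∏ m, ENNReal.ofReal (∫ v : EuclideanSpace ℝ (Fin 3), φ m v * Real.exp (-κ * ‖v‖ ^ 2)) := by
  set F : ι → EuclideanSpace ℝ (Fin 3) → ℝ≥0∞ := fun m v => ENNReal.ofReal (φ m v * Real.exp (-κ * ‖v‖ ^ 2)) with hF
  have hFm : ∀ m, Measurable (F m) := fun m =>
    ((hφm m).mul (Real.measurable_exp.comp (measurable_const.mul (measurable_norm.pow_const 2)))).ennreal_ofReal
  have hdens : ∀ p : ι → EuclideanSpace ℝ (Fin 3),
      ENNReal.ofReal (Real.exp (-su2Kinetic κ p)) * ENNReal.ofReal (∏ m, φ m (p m)) = ∏ m, F m (p m) := by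
    intro p
    have h1 : Real.exp (-su2Kinetic κ p) = ∏ m, Real.exp (-κ * ‖p m‖ ^ 2) := by
      rw [← Real.exp_sum, su2Kinetic, Finset.mul_sum, ← Finset.sum_neg_distrib]
      exact congrArg Real.exp (Finset.sum_congr rfl fun m _ => by ring)
    rw [h1, ← ENNReal.ofReal_mul (Finset.prod_nonneg fun m _ => (Real.exp_pos _).le), ← Finset.prod_mul_distrib,
      ENNReal.ofReal_prod_of_nonneg fun m _ => mul_nonneg (Real.exp_pos _).le (hφ0 m _)]
    exact Finset.prod_congr rfl fun m _ => by rw [hF, mul_comm]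
  have hmd : Measurable (fun p : ι → EuclideanSpace ℝ (Fin 3) => ENNReal.ofReal (Real.exp (-su2Kinetic κ p))) :=
    (measurable_su2Kinetic κ).neg.exp.ennreal_ofReal
  have hmφ : Measurable (fun p : ι → EuclideanSpace ℝ (Fin 3) => ENNReal.ofReal (∏ m, φ m (p m))) :=
    (Finset.measurable_prod _ fun m _ => (hφm m).comp (measurable_pi_apply m)).ennreal_ofReal
  rw [su2MomentumWeight, lintegral_withDensity_eq_lintegral_mul _ hmd hmφ]
  have hfun : ((fun p : ι → EuclideanSpace ℝ (Fin 3) => ENNReal.ofReal (Real.exp (-su2Kinetic κ p))) *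
      fun p => ENNReal.ofReal (∏ m, φ m (p m))) = fun p => ∏ m, F m (p m) := funext hdens
  rw [hfun, volume_pi, lintegral_prod_pi (fun _ : ι => (volume : Measure (EuclideanSpace ℝ (Fin 3)))) hFm]
  refine Finset.prod_congr rfl fun m _ => ?_
  rw [hF, ← ofReal_integral_eq_lintegral_ofReal (hφi m)
    (Eventually.of_forall fun v => mul_nonneg (hφ0 m v) (Real.exp_pos _).le)]

omit [DecidableEq ι] in
/-- **THE LINKS ARE INDEPENDENT UNDER THE `SU(2)` HEAT-BATH**:
`E ∏_m φ_m(p_m) = ∏_m (∫ φ_m e^{−κ‖v‖²} dv)/(∫ e^{−κ‖v‖²} dv)`. -/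
theorem integral_prod_apply_su2MomentumLaw {κ : ℝ} (hκ : 0 < κ) {φ : ι → EuclideanSpace ℝ (Fin 3) → ℝ}
    (hφ0 : ∀ m v, 0 ≤ φ m v) (hφm : ∀ m, Measurable (φ m))
    (hφi : ∀ m, Integrable (fun v => φ m v * Real.exp (-κ * ‖v‖ ^ 2))) :
    ∫ p, ∏ m, φ m (p m) ∂(su2MomentumLaw (ι := ι) κ) =
      ∏ m, (∫ v : EuclideanSpace ℝ (Fin 3), φ m v * Real.exp (-κ * ‖v‖ ^ 2)) /
        ∫ v : EuclideanSpace ℝ (Fin 3), Real.exp (-κ * ‖v‖ ^ 2) := by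
  have hJ0 := integral_exp_neg_mul_sq_norm_three_pos hκ
  have hJ0v : ∫ v : EuclideanSpace ℝ (Fin 3), Real.exp (-κ * ‖v‖ ^ 2) = (Real.pi / κ) ^ ((3 : ℝ) / 2) := by
    rw [GaussianFourier.integral_rexp_neg_mul_sq_norm hκ, finrank_euclideanSpace_fin]
    norm_num
  have hJk : ∀ m, 0 ≤ ∫ v : EuclideanSpace ℝ (Fin 3), φ m v * Real.exp (-κ * ‖v‖ ^ 2) := fun m =>
    integral_nonneg fun v => mul_nonneg (hφ0 m v) (Real.exp_pos _).le
  have hmeas : Measurable fun p : ι → EuclideanSpace ℝ (Fin 3) => ∏ m, φ m (p m) :=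
    Finset.measurable_prod _ fun m _ => (hφm m).comp (measurable_pi_apply m)
  rw [integral_eq_lintegral_of_nonneg_ae (Eventually.of_forall fun p => Finset.prod_nonneg fun m _ => hφ0 m _)
    hmeas.aestronglyMeasurable, su2MomentumLaw, lintegral_smul_measure,
    lintegral_prod_apply_su2MomentumWeight hφ0 hφm hφi, su2MomentumWeight_univ hκ, ← hJ0v, smul_eq_mul,
    ENNReal.toReal_mul, ENNReal.toReal_inv, ENNReal.toReal_pow, ENNReal.toReal_prod, ENNReal.toReal_ofReal hJ0.le]
  simp_rw [ENNReal.toReal_ofReal (hJk _)]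
  rw [Finset.prod_div_distrib, Finset.prod_const, Finset.card_univ, div_eq_inv_mul]

/-! ## §3 Two-link expectations, `E T_κ`, `E T_κ²`, `Var T_κ` -/

/-- **`E ‖p_l‖²·‖p_{l'}‖² = (3/(2κ))²` for distinct links.** -/
theorem integral_norm_sq_mul_norm_sq_su2MomentumLaw {κ : ℝ} (hκ : 0 < κ) {l l' : ι} (hll' : l ≠ l') :
    ∫ p, ‖p l‖ ^ 2 * ‖p l'‖ ^ 2 ∂(su2MomentumLaw (ι := ι) κ) = (3 / (2 * κ)) ^ 2 := by
  classical
  set φ : ι → EuclideanSpace ℝ (Fin 3) → ℝ := fun m v => if m = l ∨ m = l' then ‖v‖ ^ 2 else 1 with hφ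
  have hφ0 : ∀ m v, 0 ≤ φ m v := fun m v => by
    by_cases h : m = l ∨ m = l'
    · simp only [hφ, h, if_true]; positivity
    · simp only [hφ, h, if_false]; exact zero_le_one
  have hφm : ∀ m, Measurable (φ m) := fun m => by
    by_cases h : m = l ∨ m = l'
    · simp only [hφ, h, if_true]; exact measurable_norm.pow_const 2
    · simp only [hφ, h, if_false]; exact measurable_const
  have hi2 := integrable_norm_pow_mul_exp_neg_mul_sq_norm_three hκ 2
  have hi0 := integrable_norm_pow_mul_exp_neg_mul_sq_norm_three hκ 0
  simp only [pow_zero, one_mul] at hi0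
  have hφi : ∀ m, Integrable (fun v => φ m v * Real.exp (-κ * ‖v‖ ^ 2)) := fun m => by
    by_cases h : m = l ∨ m = l'
    · simp only [hφ, h, if_true]; exact hi2
    · simp only [hφ, h, if_false, one_mul]; exact hi0
  have hprod : ∀ p : ι → EuclideanSpace ℝ (Fin 3), ∏ m, φ m (p m) = ‖p l‖ ^ 2 * ‖p l'‖ ^ 2 := by
    intro p
    rw [← Finset.mul_prod_erase Finset.univ (fun m => φ m (p m)) (Finset.mem_univ l),
      ← Finset.mul_prod_erase (Finset.univ.erase l) (fun m => φ m (p m))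
        (Finset.mem_erase.2 ⟨hll'.symm, Finset.mem_univ l'⟩)]
    have hl : φ l (p l) = ‖p l‖ ^ 2 := by simp only [hφ, true_or, if_true]
    have hl' : φ l' (p l') = ‖p l'‖ ^ 2 := by simp only [hφ, or_true, if_true]
    have hrest : ∏ m ∈ (Finset.univ.erase l).erase l', φ m (p m) = 1 := by
      refine Finset.prod_eq_one fun m hm => ?_
      have h1 : m ≠ l' := Finset.ne_of_mem_erase hm
      have h2 : m ≠ l := Finset.ne_of_mem_erase (Finset.mem_of_mem_erase hm)
      have h : ¬(m = l ∨ m = l') := not_or.2 ⟨h2, h1⟩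
      simp only [hφ, h, if_false]
    rw [hl, hl', hrest, mul_one]
  have h := integral_prod_apply_su2MomentumLaw (ι := ι) hκ hφ0 hφm hφi
  simp_rw [hprod] at h
  rw [h]
  set Z₁ : ℝ := ∫ v : EuclideanSpace ℝ (Fin 3), Real.exp (-κ * ‖v‖ ^ 2) with hZ₁
  have hZ0 : Z₁ ≠ 0 := (integral_exp_neg_mul_sq_norm_three_pos hκ).ne'
  have hJD : (∫ v : EuclideanSpace ℝ (Fin 3), ‖v‖ ^ 2 * Real.exp (-κ * ‖v‖ ^ 2)) / Z₁ = 3 / (2 * κ) := by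
    rw [integral_norm_sq_mul_exp_neg_mul_sq_norm_three hκ, hZ₁.symm, mul_div_assoc, div_self hZ0, mul_one]
  have hratio : ∀ m, (∫ v : EuclideanSpace ℝ (Fin 3), φ m v * Real.exp (-κ * ‖v‖ ^ 2)) / Z₁ =
      if m = l ∨ m = l' then 3 / (2 * κ) else 1 := by
    intro m
    by_cases h : m = l ∨ m = l'
    · simp only [hφ, h, if_true]; exact hJD
    · simp only [hφ, h, if_false, one_mul]; exact div_self hZ0
  rw [Finset.prod_congr rfl fun m _ => hratio m,
    ← Finset.mul_prod_erase Finset.univ _ (Finset.mem_univ l),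
    ← Finset.mul_prod_erase (Finset.univ.erase l) _ (Finset.mem_erase.2 ⟨hll'.symm, Finset.mem_univ l'⟩)]
  have hrest1 : ∏ m ∈ (Finset.univ.erase l).erase l', (if m = l ∨ m = l' then 3 / (2 * κ) else (1 : ℝ)) = 1 := by
    refine Finset.prod_eq_one fun m hm => ?_
    have h1 : m ≠ l' := Finset.ne_of_mem_erase hm
    have h2 : m ≠ l := Finset.ne_of_mem_erase (Finset.mem_of_mem_erase hm)
    rw [if_neg (not_or.2 ⟨h2, h1⟩)]
  rw [hrest1, if_pos (Or.inl rfl), if_pos (Or.inr rfl), mul_one, sq]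

/-- `‖p_l‖²‖p_{l'}‖²` is integrable under the momentum law (any two links; `ab ≤ (a²+b²)/2`). -/
theorem integrable_norm_sq_mul_norm_sq_su2MomentumLaw {κ : ℝ} (hκ : 0 < κ) (l l' : ι) :
    Integrable (fun p : ι → EuclideanSpace ℝ (Fin 3) => ‖p l‖ ^ 2 * ‖p l'‖ ^ 2) (su2MomentumLaw (ι := ι) κ) := by
  refine (((integrable_norm_apply_pow_su2MomentumLaw (ι := ι) hκ 4 l).add
    (integrable_norm_apply_pow_su2MomentumLaw (ι := ι) hκ 4 l')).div_const 2).mono'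
    (((measurable_pi_apply l).norm.pow_const 2).mul ((measurable_pi_apply l').norm.pow_const 2)).aestronglyMeasurable
    (Eventually.of_forall fun p => ?_)
  rw [Real.norm_eq_abs, abs_of_nonneg (by positivity)]
  have hsq := sq_nonneg (‖p l‖ ^ 2 - ‖p l'‖ ^ 2)
  have hexp : (‖p l‖ ^ 2 - ‖p l'‖ ^ 2) ^ 2 = ‖p l‖ ^ 4 + ‖p l'‖ ^ 4 - 2 * (‖p l‖ ^ 2 * ‖p l'‖ ^ 2) := by ring
  simp only [Pi.add_apply] at *
  linarith

/-- **`E T_κ = 3|ι|/2`** (`κ`-free): the mean of the `SU(2)` heat-bath's kinetic energy. -/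
theorem integral_su2Kinetic_su2MomentumLaw {κ : ℝ} (hκ : 0 < κ) :
    ∫ p, su2Kinetic κ p ∂(su2MomentumLaw (ι := ι) κ) = Fintype.card ι * (3 / 2 : ℝ) := by
  have hi2 := fun l : ι => integrable_norm_apply_pow_su2MomentumLaw (ι := ι) hκ 2 l
  calc ∫ p, su2Kinetic κ p ∂(su2MomentumLaw (ι := ι) κ)
      = ∫ p, κ * ∑ l, ‖p l‖ ^ 2 ∂(su2MomentumLaw (ι := ι) κ) := integral_congr_ae (Eventually.of_forall fun p => rfl)
    _ = κ * ∑ l, ∫ p, ‖p l‖ ^ 2 ∂(su2MomentumLaw (ι := ι) κ) := by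
        rw [integral_const_mul, integral_finsetSum _ fun l _ => hi2 l]
    _ = κ * ∑ _l : ι, 3 / (2 * κ) := by
        rw [Finset.sum_congr rfl fun l _ => integral_norm_apply_sq_su2MomentumLaw (ι := ι) hκ l]
    _ = Fintype.card ι * (3 / 2 : ℝ) := by
        rw [Finset.sum_const, Finset.card_univ, nsmul_eq_mul]
        field_simp

/-- **`E T_κ² = 3|ι|/2 + (3|ι|/2)²`.** -/
theorem integral_su2Kinetic_sq_su2MomentumLaw {κ : ℝ} (hκ : 0 < κ) :
    ∫ p, su2Kinetic κ p ^ 2 ∂(su2MomentumLaw (ι := ι) κ) =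
      Fintype.card ι * (3 / 2 : ℝ) + (Fintype.card ι * (3 / 2 : ℝ)) ^ 2 := by
  classical
  set ν := su2MomentumLaw (ι := ι) κ with hν
  have hsq : ∀ p : ι → EuclideanSpace ℝ (Fin 3), su2Kinetic κ p ^ 2 = κ ^ 2 * ∑ l, ∑ l', ‖p l‖ ^ 2 * ‖p l'‖ ^ 2 := by
    intro p; rw [su2Kinetic, mul_pow, sq (∑ l, ‖p l‖ ^ 2), Finset.sum_mul_sum]
  simp_rw [hsq]
  rw [integral_const_mul, integral_finsetSum _ fun l _ => integrable_finsetSum _ fun l' _ =>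
    integrable_norm_sq_mul_norm_sq_su2MomentumLaw (ι := ι) hκ l l']
  have hinner : ∀ l : ι, ∫ p, ∑ l', ‖p l‖ ^ 2 * ‖p l'‖ ^ 2 ∂ν = 15 / (4 * κ ^ 2) + (Fintype.card ι - 1) * (3 / (2 * κ)) ^ 2 := by
    intro l
    rw [integral_finsetSum _ fun l' _ => integrable_norm_sq_mul_norm_sq_su2MomentumLaw (ι := ι) hκ l l',
      ← Finset.add_sum_erase _ _ (Finset.mem_univ l)]
    have hdiag : ∫ p, ‖p l‖ ^ 2 * ‖p l‖ ^ 2 ∂ν = 15 / (4 * κ ^ 2) := by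
      rw [← integral_norm_apply_pow_four_su2MomentumLaw (ι := ι) hκ l]
      exact integral_congr_ae (Eventually.of_forall fun p => by ring)
    have hoff : ∑ l' ∈ Finset.univ.erase l, ∫ p, ‖p l‖ ^ 2 * ‖p l'‖ ^ 2 ∂ν = ∑ _l' ∈ Finset.univ.erase l, (3 / (2 * κ)) ^ 2 :=
      Finset.sum_congr rfl fun l' hl' =>
        integral_norm_sq_mul_norm_sq_su2MomentumLaw (ι := ι) hκ (Finset.ne_of_mem_erase hl').symm
    rw [hdiag, hoff, Finset.sum_const, Finset.card_erase_of_mem (Finset.mem_univ l), Finset.card_univ, nsmul_eq_mul,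
      Nat.cast_sub (Fintype.card_pos_iff.2 ⟨l⟩), Nat.cast_one]
  rw [Finset.sum_congr rfl fun l _ => hinner l, Finset.sum_const, Finset.card_univ, nsmul_eq_mul]
  field_simp
  ring

/-- **`Var T_κ = E(T_κ − 3|ι|/2)² = 3|ι|/2`** — the error bar of the `SU(2)` equipartition check, exactly. -/
theorem variance_su2Kinetic_su2MomentumLaw {κ : ℝ} (hκ : 0 < κ) :
    ∫ p, (su2Kinetic κ p - Fintype.card ι * (3 / 2 : ℝ)) ^ 2 ∂(su2MomentumLaw (ι := ι) κ) =
      Fintype.card ι * (3 / 2 : ℝ) := by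
  haveI : Fact (0 < κ) := ⟨hκ⟩
  set ν := su2MomentumLaw (ι := ι) κ with hν
  set M : ℝ := Fintype.card ι * (3 / 2 : ℝ) with hM
  have hi1 : Integrable (su2Kinetic (ι := ι) κ) ν := by
    have h : su2Kinetic (ι := ι) κ = fun p => κ * ∑ l, ‖p l‖ ^ 2 := rfl
    rw [h]
    exact (integrable_finsetSum _ fun l _ => integrable_norm_apply_pow_su2MomentumLaw (ι := ι) hκ 2 l).const_mul κ
  have hi2 : Integrable (fun p : ι → EuclideanSpace ℝ (Fin 3) => su2Kinetic κ p ^ 2) ν := by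
    have h : ∀ p : ι → EuclideanSpace ℝ (Fin 3), su2Kinetic κ p ^ 2 = κ ^ 2 * ∑ l, ∑ l', ‖p l‖ ^ 2 * ‖p l'‖ ^ 2 := by
      intro p; rw [su2Kinetic, mul_pow, sq (∑ l, ‖p l‖ ^ 2), Finset.sum_mul_sum]
    simp_rw [h]
    exact (integrable_finsetSum _ fun l _ => integrable_finsetSum _ fun l' _ =>
      integrable_norm_sq_mul_norm_sq_su2MomentumLaw (ι := ι) hκ l l').const_mul _
  have hexp : ∀ p : ι → EuclideanSpace ℝ (Fin 3), (su2Kinetic κ p - M) ^ 2 = su2Kinetic κ p ^ 2 - 2 * M * su2Kinetic κ p + M ^ 2 := by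
    intro p; ring
  simp_rw [hexp]
  have hMq : Integrable (fun p : ι → EuclideanSpace ℝ (Fin 3) => 2 * M * su2Kinetic κ p) ν := hi1.const_mul _
  have hsub : Integrable (fun p : ι → EuclideanSpace ℝ (Fin 3) => su2Kinetic κ p ^ 2 - 2 * M * su2Kinetic κ p) ν := hi2.sub hMq
  rw [integral_add hsub (integrable_const _), integral_sub hi2 hMq, integral_const_mul, integral_const, smul_eq_mul,
    probReal_univ, one_mul, integral_su2Kinetic_sq_su2MomentumLaw (ι := ι) hκ, integral_su2Kinetic_su2MomentumLaw (ι := ι) hκ, ← hM]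
  ring

end Product

end Summit.Ventures.LatticeQCDFlow.Exactness
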